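import Summits.AtomisticToContinuum.BoseEinsteinCondensation.Theses.BECDispersionLadder
import Summits.AtomisticToContinuum.BoseEinsteinCondensation.Theorems.BECInsertionCorrectorStaticResponseBoundTruncationCompactness
import Literature.MathematicalPhysics.QuantumManyBody.PeriodicBoseGasFracEnergy
import Literature.MathematicalPhysics.QuantumManyBody.PeriodicFormCoreTrigPoly
import Literature.MathematicalPhysics.QuantumManyBody.PeriodicBoseGasEq317Bdd
import HarnessLib

/-!
# Route `BECDispersionLadder`, support item `EndpointTransfer` (stmt-AtomisticToContinuum-14557), I:
# plane-wave occupations through the Fourier coefficients of the `3N`-torus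

Helper file (supports, does not close, stmt-AtomisticToContinuum-14557). The route's fractional energy
`E_α(Ψ) = ∑_{p ∈ ℤ³} |2πp/L|^α n_Ψ(p) + ∫ V|Ψ|²` is written through the one-particle plane-wave occupations
`n_Ψ(p) = cellOccupation N L (planeWaveMode L p) Ψ` (traced variable), while the compactness / form-core
machinery of the tree (`PeriodicFormDomain`, `PeriodicMaxFormBound`) speaks the FULL Fourier coefficients
`⟪e_ν, ι(graphEmbed Ψ)⟫`, `ν ∈ ℤ^{3N}`, of the embedded class on `L²((ℝ/ℤ)^{3N})`. This file is the dictionary: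

* `integral_cellN_succ` — Bochner–Fubini `∫_{Ω^{n+1}} F = ∫_{Ω^n} ∫_Ω F(x, Y) dx dY`;
* `configFourierCoeff_vecCons` — the full coefficient at the momentum `(p, m)` is the `m`-th coefficient (in the
  spectator variables) of the slice coefficient `Y ↦ ĉ_p(Ψ(·, Y))`;
* `cellOccupation_planeWaveMode_eq_tsum` — `n_Ψ(p) = N L^{3N} ∑_m |ĉ_{(p,m)}(Ψ)|²` (Parseval in the spectators);
* `tsum_mul_cellOccupation_eq_tsum_inner` — for every weight `w` on `ℤ³` and every periodic trial state,
  `∑_p w(p) n_Ψ(p) = ∑_ν (∑ᵢ w(νᵢ)) |⟪e_ν, ι(graphEmbed Ψ)⟫|²` (Bose symmetry spreads the traced particle over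
  all slots), whence the kinetic part of `E_α` is the spectral sum with weight `∑ᵢ |2πνᵢ/L|^α`
  (`fracKinetic_eq_tsum_inner`), which at `α = 2` is the tree's weight `∑_q (2πν_q/L)²` (`sum_fracDispersion_two`).

References: [LSSY2005] App. A (A.10)–(A.13) (momentum representation of `∑ᵢ(-Δᵢ)` and of `a†a`).
-/

noncomputable section

open MeasureTheory Filter UnitAddTorus Complex
open scoped ENNReal NNReal BigOperators Topology InnerProductSpace ComplexConjugate

namespace Summit.AtomisticToContinuum.BoseEinsteinCondensation.Theorems

open Literature.MathematicalPhysics.QuantumManyBody.BoseGas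
open Summit.AtomisticToContinuum.BoseEinsteinCondensation.Cruxes.StaticResponseBound.UvThomsonForceWave

-- The measure on `ℝ/ℤ` is the Haar PROBABILITY measure, as in `PeriodicFormDomain.lean`.
attribute [local instance] Literature.MathematicalPhysics.QuantumManyBody.BoseGas.formDomain_measureSpace
  Literature.MathematicalPhysics.QuantumManyBody.BoseGas.formDomain_isProbabilityMeasure
  Literature.MathematicalPhysics.QuantumManyBody.BoseGas.formDomain_isProbabilityMeasure_pi

namespace EndpointTransfer

variable {n N : ℕ} {L : ℝ}

/-! ### Fubini on the cell, first particle split off (Bochner version) -/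

/-- **Fubini, first particle split off** (Bochner): `∫_{Ω^{n+1}} F = ∫_{Ω^n} ∫_Ω F(x, Y) dx dY` for `F`
integrable on the cell (`Ω^{n+1} ≅ Ω × Ω^n` is measure preserving). [folklore] -/
theorem integral_cellN_succ (L : ℝ) {F : Config (n + 1) → ℂ}
    (hF : Integrable F (volume.restrict (cellN (n + 1) L))) :
    ∫ X in cellN (n + 1) L, F X = ∫ Y in cellN n L, ∫ x in cell L, F (Matrix.vecCons x Y) := by
  set μ : Fin (n + 1) → Measure Space := fun _ => volume.restrict (cell L) with hμ
  have hmp := measurePreserving_piFinSuccAbove μ 0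
  have hG : ∀ (x : Space) (Y : Config n),
      (MeasurableEquiv.piFinSuccAbove (fun _ : Fin (n + 1) => Space) 0).symm (x, Y) =
        Matrix.vecCons x Y := by
    intro x Y
    change Fin.insertNth 0 x Y = (Fin.cons x Y : Config (n + 1))
    exact Fin.insertNth_zero' x Y
  have hF' : Integrable F (Measure.pi μ) := by rwa [volume_restrict_cellN] at hF
  have hint : Integrable (fun z : Space × Config n =>
      F ((MeasurableEquiv.piFinSuccAbove (fun _ : Fin (n + 1) => Space) 0).symm z))
      ((μ 0).prod (Measure.pi fun j => μ (Fin.succAbove 0 j))) :=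
    ((hmp.symm _).integrable_comp_emb (MeasurableEquiv.measurableEmbedding _)).2 hF'
  rw [volume_restrict_cellN, volume_restrict_cellN, ← (hmp.symm _).integral_comp',
    integral_prod_symm _ hint]
  simp only [hG]
  rfl

/-! ### The full Fourier coefficients through the slices -/

/-- The `(n+1)`-body plane wave at the momentum `(p, m)` factorises at a sliced configuration:
`e_{(p,m)}(x, Y) = e_p(x) e_m(Y)`. [folklore] -/
theorem cellWaveN_vecCons (L : ℝ) (p : Fin 3 → ℤ) (m : Fin n × Fin 3 → ℤ) (x : Space) (Y : Config n) :
    cellWaveN L (fun q : Fin (n + 1) × Fin 3 =>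
        (Matrix.vecCons p (fun i k => m (i, k)) : Fin (n + 1) → Fin 3 → ℤ) q.1 q.2) (Matrix.vecCons x Y) =
      cellWave L p x * cellWaveN L m Y := by
  rw [cellWaveN_eq_prod, cellWaveN_eq_prod, Fin.prod_univ_succ]
  simp only [Matrix.cons_val_zero, Matrix.cons_val_succ]

/-- A continuous globally bounded `N`-body function is integrable on the cell against any bounded
continuous weight; here: `conj(e_ν) Ψ` is integrable on `[0,L)^{3N}`. [folklore] -/
theorem integrable_conj_cellWaveN_mul (L : ℝ) {Ψ : Config N → ℂ} (hΨc : Continuous Ψ) {C : ℝ}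
    (hbd : ∀ X, ‖Ψ X‖ ≤ C) (ν : Fin N × Fin 3 → ℤ) :
    Integrable (fun X => conj (cellWaveN L ν X) * Ψ X) (volume.restrict (cellN N L)) := by
  have hvol : volume (cellN N L) < ⊤ := by
    rw [volume_cellN]; exact ENNReal.pow_lt_top (ENNReal.pow_lt_top ENNReal.ofReal_lt_top)
  refine Measure.integrableOn_of_bounded (M := C) hvol.ne
    (((continuous_cellWaveN L ν).star.mul hΨc).aestronglyMeasurable) ?_
  refine Eventually.of_forall fun X => ?_
  rw [norm_mul, RCLike.norm_conj, norm_cellWaveN, one_mul]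
  exact hbd X

/-- The slice coefficients `Y ↦ ĉ_p(Ψ(·, Y))` of a continuous globally bounded `Ψ` are continuous in the
spectator variables (dominated convergence on the cell). [folklore] -/
theorem continuous_sliceCoeff {L : ℝ} (hL : 0 < L) {Ψ : Config (n + 1) → ℂ} (hΨc : Continuous Ψ) {C : ℝ}
    (hbd : ∀ X, ‖Ψ X‖ ≤ C) (p : Fin 3 → ℤ) :
    Continuous fun Y : Config n => cellFourierCoeff L (fun x => Ψ (Matrix.vecCons x Y)) p := by
  simp only [cellFourierCoeff_eq_integral hL]
  refine Continuous.const_smul ?_ ((L ^ 3)⁻¹ : ℝ)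
  have hvol : volume (cell L) < ⊤ := by rw [volume_cell]; exact ENNReal.pow_lt_top ENNReal.ofReal_lt_top
  haveI : IsFiniteMeasure (volume.restrict (cell L)) := ⟨by rwa [Measure.restrict_apply_univ]⟩
  refine continuous_of_dominated (bound := fun _ => C) ?_ ?_ (integrable_const C) ?_
  · intro Y
    exact ((continuous_cellWave_conj L p).mul
      (hΨc.comp (continuous_id.matrixVecCons continuous_const))).aestronglyMeasurable
  · intro Y
    refine Eventually.of_forall fun x => ?_
    rw [norm_mul, RCLike.norm_conj, norm_cellWave, one_mul]
    exact hbd _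
  · refine Eventually.of_forall fun x => ?_
    exact continuous_const.mul (hΨc.comp (continuous_const.matrixVecCons continuous_id))
where
  /-- `x ↦ conj(e_p(x))` is continuous. [folklore] -/
  continuous_cellWave_conj (L : ℝ) (p : Fin 3 → ℤ) : Continuous fun x => conj (cellWave L p x) :=
    (contDiff_cellWave L p).continuous.star

/-- **The full coefficient at `(p, m)` is the spectator coefficient of the slice coefficient**:
`ĉ_{(p,m)}(Ψ) = ĉ_m(Y ↦ ĉ_p(Ψ(·, Y)))` (Fubini on `Ω^{n+1} = Ω × Ω^n` with `e_{(p,m)} = e_p ⊗ e_m`). [folklore] -/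
theorem configFourierCoeff_vecCons (hL : 0 < L) {Ψ : Config (n + 1) → ℂ} (hΨc : Continuous Ψ) {C : ℝ}
    (hbd : ∀ X, ‖Ψ X‖ ≤ C) (p : Fin 3 → ℤ) (m : Fin n × Fin 3 → ℤ) :
    configFourierCoeff L Ψ (fun q : Fin (n + 1) × Fin 3 =>
        (Matrix.vecCons p (fun i k => m (i, k)) : Fin (n + 1) → Fin 3 → ℤ) q.1 q.2) =
      configFourierCoeff L (fun Y : Config n => cellFourierCoeff L (fun x => Ψ (Matrix.vecCons x Y)) p) m := by
  have hg := continuous_sliceCoeff hL hΨc hbd p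
  rw [configFourierCoeff_eq_integral hL hΨc.aestronglyMeasurable,
    configFourierCoeff_eq_integral hL hg.aestronglyMeasurable,
    integral_cellN_succ L (integrable_conj_cellWaveN_mul L hΨc hbd _)]
  simp only [cellWaveN_vecCons, map_mul, cellFourierCoeff_eq_integral hL]
  rw [pow_succ, mul_smul, ← integral_smul]
  congr 1
  refine integral_congr_ae (Eventually.of_forall fun Y => ?_)
  dsimp only
  rw [mul_smul_comm, ← integral_const_mul]
  refine congrArg _ (integral_congr_ae (Eventually.of_forall fun x => ?_))
  dsimp only
  ring

/-! ### Occupations of the plane waves through the full coefficients -/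

/-- **Parseval in the spectator variables**: for a continuous globally bounded `(n+1)`-body `Ψ`,
`n_Ψ(p) = cellOccupation (n+1) L φ_p Ψ = (n+1) L^{3(n+1)} ∑_m |ĉ_{(p,m)}(Ψ)|²`. [cite: LSSY2005, App. A (A.11)–(A.13)] -/
theorem cellOccupation_planeWaveMode_eq_tsum (hL : 0 < L) {Ψ : Config (n + 1) → ℂ} (hΨc : Continuous Ψ)
    {C : ℝ} (hbd : ∀ X, ‖Ψ X‖ ≤ C) (p : Fin 3 → ℤ) :
    cellOccupation (n + 1) L (planeWaveMode L p) Ψ =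
      (n + 1 : ℝ≥0∞) * (ENNReal.ofReal L ^ 3) ^ (n + 1) *
        ∑' m : Fin n × Fin 3 → ℤ, (‖configFourierCoeff L Ψ (fun q : Fin (n + 1) × Fin 3 =>
          (Matrix.vecCons p (fun i k => m (i, k)) : Fin (n + 1) → Fin 3 → ℤ) q.1 q.2)‖₊ : ℝ≥0∞) ^ 2 := by
  have hL3 : ENNReal.ofReal L ^ 3 ≠ 0 := pow_ne_zero _ (by simpa using hL)
  have hL3' : ENNReal.ofReal L ^ 3 ≠ ⊤ := ENNReal.pow_ne_top ENNReal.ofReal_ne_top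
  have hg := continuous_sliceCoeff hL hΨc hbd p
  -- Parseval for the slice coefficient function on `Ω^n`
  have hP := tsum_sq_configFourierCoeff hL hg
  simp only [← configFourierCoeff_vecCons hL hΨc hbd p] at hP
  have hint : ∫⁻ Y in cellN n L, (‖cellFourierCoeff L (fun x => Ψ (Matrix.vecCons x Y)) p‖₊ : ℝ≥0∞) ^ 2 =
      (ENNReal.ofReal L ^ 3) ^ n * ∑' m : Fin n × Fin 3 → ℤ, (‖configFourierCoeff L Ψ
        (fun q : Fin (n + 1) × Fin 3 => (Matrix.vecCons p (fun i k => m (i, k)) : Fin (n + 1) → Fin 3 → ℤ)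
          q.1 q.2)‖₊ : ℝ≥0∞) ^ 2 := by
    rw [hP, ← mul_assoc, ← mul_pow, ENNReal.mul_inv_cancel hL3 hL3', one_pow, one_mul]
  rw [cellOccupation_succ]
  simp only [nnnorm_sq_integral_conj_planeWaveMode_mul hL]
  rw [lintegral_const_mul' _ _ hL3', hint, pow_succ]
  ring

/-- **Weighted occupation sums through the full coefficients** (traced particle in slot `0`): for every
weight `w` on `ℤ³`, `∑_p w(p) n_Ψ(p) = (n+1) L^{3(n+1)} ∑_ν w(ν₀) |ĉ_ν(Ψ)|²`. [cite: LSSY2005, App. A (A.10)–(A.13)] -/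
theorem tsum_mul_cellOccupation_eq_tsum_coeff (hL : 0 < L) {Ψ : Config (n + 1) → ℂ} (hΨc : Continuous Ψ)
    {C : ℝ} (hbd : ∀ X, ‖Ψ X‖ ≤ C) (w : (Fin 3 → ℤ) → ℝ≥0∞) :
    ∑' p : Fin 3 → ℤ, w p * cellOccupation (n + 1) L (planeWaveMode L p) Ψ =
      (n + 1 : ℝ≥0∞) * (ENNReal.ofReal L ^ 3) ^ (n + 1) *
        ∑' ν : Fin (n + 1) × Fin 3 → ℤ, w (fun k => ν (0, k)) * (‖configFourierCoeff L Ψ ν‖₊ : ℝ≥0∞) ^ 2 := by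
  simp only [cellOccupation_planeWaveMode_eq_tsum hL hΨc hbd, mul_left_comm (w _), ← ENNReal.tsum_mul_left (a := w _)]
  rw [ENNReal.tsum_mul_left]
  congr 1
  -- reindex `ℤ³ × ℤ^{3n} ≃ ℤ^{3(n+1)}`
  set e : (Fin 3 → ℤ) × (Fin n × Fin 3 → ℤ) ≃ (Fin (n + 1) × Fin 3 → ℤ) :=
    (Equiv.prodCongr (Equiv.refl (Fin 3 → ℤ)) (Equiv.curry (Fin n) (Fin 3) ℤ)).trans
      ((Fin.consEquiv (fun _ : Fin (n + 1) => Fin 3 → ℤ)).trans (Equiv.curry (Fin (n + 1)) (Fin 3) ℤ).symm)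
    with he
  symm
  rw [← Equiv.tsum_eq e, ENNReal.tsum_prod']
  refine tsum_congr fun p => tsum_congr fun m => ?_
  rfl

/-! ### Bose symmetry spreads the traced particle over all slots -/

/-- **Symmetrisation over the slots**: if a weight `a` on `ℤ^{3N}` is invariant under the particle
permutations of the momenta, then `N ∑_ν w(ν₀) a(ν) = ∑_ν (∑ᵢ w(νᵢ)) a(ν)`. [folklore] -/
theorem natCast_mul_tsum_eq_tsum_sum_mul (w : (Fin 3 → ℤ) → ℝ≥0∞) {a : (Fin (n + 1) × Fin 3 → ℤ) → ℝ≥0∞}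
    (ha : ∀ (σ : Equiv.Perm (Fin (n + 1))) (ν : Fin (n + 1) × Fin 3 → ℤ), a (fun q => ν (σ q.1, q.2)) = a ν) :
    (n + 1 : ℝ≥0∞) * ∑' ν : Fin (n + 1) × Fin 3 → ℤ, w (fun k => ν (0, k)) * a ν =
      ∑' ν : Fin (n + 1) × Fin 3 → ℤ, (∑ i : Fin (n + 1), w (fun k => ν (i, k))) * a ν := by
  simp only [Finset.sum_mul]
  rw [Summable.tsum_finsetSum (fun _ _ => ENNReal.summable)]
  have hi : ∀ i : Fin (n + 1), ∑' ν : Fin (n + 1) × Fin 3 → ℤ, w (fun k => ν (i, k)) * a ν =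
      ∑' ν : Fin (n + 1) × Fin 3 → ℤ, w (fun k => ν (0, k)) * a ν := by
    intro i
    set τ : (Fin (n + 1) × Fin 3 → ℤ) ≃ (Fin (n + 1) × Fin 3 → ℤ) :=
      Equiv.arrowCongr (Equiv.prodCongr (Equiv.swap 0 i) (Equiv.refl (Fin 3))).symm (Equiv.refl ℤ) with hτ
    rw [← Equiv.tsum_eq τ]
    refine tsum_congr fun ν => ?_
    have hτν : τ ν = fun q => ν (Equiv.swap 0 i q.1, q.2) := by
      funext q; rfl
    rw [hτν, ha (Equiv.swap 0 i) ν]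
    simp only [Equiv.swap_apply_right]
  simp only [hi, Finset.sum_const, Finset.card_univ, Fintype.card_fin, nsmul_eq_mul, Nat.cast_add,
    Nat.cast_one]

/-! ### The dictionary for periodic trial states -/

/-- **Weighted plane-wave occupations are spectral sums over the `3N`-torus.** For every weight `w` on `ℤ³`
and every periodic trial state, `∑_p w(p) n_Ψ(p) = ∑_ν (∑ᵢ w(νᵢ)) |⟪e_ν, ι(graphEmbed Ψ)⟫|²`, `ι` the free
form-domain embedding into `L²((ℝ/ℤ)^{3N})` (Parseval in the spectator variables and Bose symmetry).
[cite: LSSY2005, App. A (A.10)–(A.13)] -/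
theorem tsum_mul_cellOccupation_eq_tsum_inner (hL : 0 < L) (Ψ : PeriodicTrialState N L)
    (w : (Fin 3 → ℤ) → ℝ≥0∞) :
    ∑' p : Fin 3 → ℤ, w p * cellOccupation N L (planeWaveMode L p) Ψ.ψ =
      ∑' ν : Fin N × Fin 3 → ℤ, (∑ i : Fin N, w (fun k => ν (i, k))) *
        (‖⟪(mFourierLp 2 ν : Lp ℂ 2 (volume : Measure (UnitAddTorus (Fin N × Fin 3)))),
          formEmbed hL measurable_zeroProfile (lintegral_periodicInteraction_zero_ne_top N L)
            ⟨graphEmbed hL measurable_zeroProfile (lintegral_periodicInteraction_zero_ne_top N L)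
              ⟨Ψ.ψ, Ψ.mem_periodicCore⟩, graphEmbed_mem_formDomain _ _ _ _⟩⟫_ℂ‖₊ : ℝ≥0∞) ^ 2 := by
  cases N with
  | zero => simp [cellOccupation, occupation]
  | succ n =>
    obtain ⟨C, hC⟩ := Ψ.exists_norm_le hL
    simp only [inner_mFourierLp_formEmbed_trialState hL Ψ, coe_nnnorm_real_mul_sq (cellScale_nonneg (n + 1) L)]
    have hscale : ENNReal.ofReal (cellScale (n + 1) L ^ 2) = (ENNReal.ofReal L ^ 3) ^ (n + 1) := by
      rw [cellScale_sq hL.le, ENNReal.ofReal_pow (by positivity), ENNReal.ofReal_pow hL.le]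
    simp only [hscale, mul_left_comm _ ((ENNReal.ofReal L ^ 3) ^ (n + 1))]
    simp only [ENNReal.tsum_mul_left]
    rw [tsum_mul_cellOccupation_eq_tsum_coeff hL Ψ.contDiff.continuous hC w,
      ← natCast_mul_tsum_eq_tsum_sum_mul w fun σ ν => by rw [configFourierCoeff_perm Ψ.symm σ ν]]
    ring

/-- The kinetic part of the route's fractional energy as a spectral sum:
`∑_p |2πp/L|^α n_Ψ(p) = ∑_ν (∑ᵢ |2πνᵢ/L|^α) |⟪e_ν, ι(graphEmbed Ψ)⟫|²`. [cite: LSSY2005, App. A (A.10)] -/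
theorem fracKinetic_eq_tsum_inner (hL : 0 < L) (Ψ : PeriodicTrialState N L) (α : ℝ) :
    ∑' p : Fin 3 → ℤ, fracDispersion α L p * cellOccupation N L (planeWaveMode L p) Ψ.ψ =
      ∑' ν : Fin N × Fin 3 → ℤ, (∑ i : Fin N, fracDispersion α L (fun k => ν (i, k))) *
        (‖⟪(mFourierLp 2 ν : Lp ℂ 2 (volume : Measure (UnitAddTorus (Fin N × Fin 3)))),
          formEmbed hL measurable_zeroProfile (lintegral_periodicInteraction_zero_ne_top N L)
            ⟨graphEmbed hL measurable_zeroProfile (lintegral_periodicInteraction_zero_ne_top N L)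
              ⟨Ψ.ψ, Ψ.mem_periodicCore⟩, graphEmbed_mem_formDomain _ _ _ _⟩⟫_ℂ‖₊ : ℝ≥0∞) ^ 2 :=
  tsum_mul_cellOccupation_eq_tsum_inner hL Ψ (fracDispersion α L)

/-- At `α = 2` the symmetrised dispersion is the tree's spectral weight:
`∑ᵢ |2πνᵢ/L|² = ∑_q (2πν_q/L)²`. [folklore] -/
theorem sum_fracDispersion_two (L : ℝ) (ν : Fin N × Fin 3 → ℤ) :
    ∑ i : Fin N, fracDispersion 2 L (fun k => ν (i, k)) =
      ENNReal.ofReal (∑ q : Fin N × Fin 3, (2 * Real.pi * (ν q : ℝ) / L) ^ 2) := by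
  simp only [fracDispersion_two]
  rw [← ENNReal.ofReal_sum_of_nonneg (fun i _ => by positivity), Fintype.sum_prod_type]
  congr 1
  refine Finset.sum_congr rfl fun i _ => ?_
  rw [Finset.mul_sum, Finset.sum_div]
  refine Finset.sum_congr rfl fun k _ => ?_
  ring

end EndpointTransfer

end Summit.AtomisticToContinuum.BoseEinsteinCondensation.Theorems

end
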